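import Literature.NumberTheory.GaloisRepresentations.LocalReciprocityCrossConjData
import Literature.NumberTheory.GaloisRepresentations.LocalWeilDatumNorm
import HarnessLib

/-!
# Conjugation-equivariance of the local reciprocity maps ACROSS two finite subextensions

J. Neukirch, *Algebraic Number Theory*, Ch. IV, Prop. (5.8) ("`(σ a, σL|σK) = σ (a, L|K) σ⁻¹`"), for
a non-archimedean local field `F`, finite separable `E₁`, `E₂` over `F` read inside `F̄`
(`E_{i0} = ι_i⁻¹(E_i)`), and `g ∈ Γ_F` with `g E₁₀ = E₂₀` — continuation of
`LocalReciprocityCrossConjData.lean` (conjugation data `φ_g`, `γ_g`, datum-side lemmas):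

* §4 `mem_reps_of_absGaloisRestrict_eq_conj₂`: the representatives of Serre's `θ_{E₁} x` are carried
  to those of `θ_{E₂} (γ x)` by `σ ↦ σ'` with `res₂ σ' = ρ̂ · res₁ σ · ρ̂⁻¹` (`ρ ∈ W_F`);
* §5 `reciprocity_conj_of_characterized`: for ANY maps `Art_i : E_{i0}ˣ → Gal(F̄/E_{i0})^ab`
  characterised by the finite abelian shadows of `θ_{E_i}` (the characterisation clause of the abc-iut
  cell's `exists_reciprocity_characterized_embField`), `Art₁ u = [h] ⟹ Art₂ (g u) = [g h g⁻¹]` for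
  EVERY `g ∈ Γ_F` with `g E₁₀ = E₂₀` (density of `W_F` in `Γ_F`).  No normality assumed.

Use ([AbsAnab] Prop. 1.2.1 (vi), [AbsTopIII] Cor. 1.10 (i)(a)): the conjugation compatibility (T3) of
the torsion reciprocity data `θ_U : (U^ab)_tors → k̄ˣ` over ALL open subgroups `U ≤ G_k` of an MLF.
Proof-only; classical local class field theory.  HONEST FRAMING (abc-iut cell): nothing here bears
on [IUTchIII] Cor. 3.12.  References: [NeukirchANT1999] IV (5.8); [TateCorvallis1979] (1.4.5);
[MochizukiAbsAnab2004] §1.2.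
-/

noncomputable section

open Field IsNonarchimedeanLocalField ValuativeRel
open scoped Pointwise

namespace Literature.NumberTheory.GaloisRepresentations

namespace LocalWeilDatum

open AbstractCFT AbstractCFT.WeilDatum


/-! ### §4 Transport of the representatives of `θ_{E₁} x` to those of `θ_{E₂} (γ x)` -/

section Reps

variable {F E₁ E₂ : Type*} [Field F] [ValuativeRel F] [TopologicalSpace F]
  [IsNonarchimedeanLocalField F]
  [Field E₁] [Algebra F E₁] [FiniteDimensional F E₁] [Algebra.IsSeparable F E₁]
  [ValuativeRel E₁] [TopologicalSpace E₁] [IsNonarchimedeanLocalField E₁] [ValuativeExtension F E₁]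
  [Field E₂] [Algebra F E₂] [FiniteDimensional F E₂] [Algebra.IsSeparable F E₂]
  [ValuativeRel E₂] [TopologicalSpace E₂] [IsNonarchimedeanLocalField E₂] [ValuativeExtension F E₂]

/-- **Representatives transport across two fields**: if `σ ∈ Γ_{E₁}` represents `(x, */E₁)` (i.e.
`σ|_{L'} = (x, L'/E₁)` for every finite abelian `L'/E₁`) and `res₂ σ' = ρ · res₁ σ · ρ⁻¹` in `Γ_F`
(`ρ ∈ W_F`, `ρ E₁₀ = E₂₀`), then `σ' ∈ Γ_{E₂}` represents `(γ x, */E₂)` for `γ = ρ|_{E₁}`.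
[cite: NeukirchANT1999, Ch. IV Prop. (5.8)] -/
theorem mem_reps_of_absGaloisRestrict_eq_conj₂ (hcf : (localWeilDatum F).IsClassFieldTheory)
    (ρ : WeilGroup F)
    (hρ : ∀ a, WeilGroup.toAbsGalois F ρ • a ∈ embField F E₂ ↔ a ∈ embField F E₁)
    {φ : AlgebraicClosure E₁ ≃+* AlgebraicClosure E₂}
    (hφι : ∀ a, φ (absClosureEmbedding F E₁ a) =
      absClosureEmbedding F E₂ (WeilGroup.toAbsGalois F ρ • a))
    {γ : E₁ ≃+* E₂}
    (hφ : ∀ x : E₁, φ (algebraMap E₁ (AlgebraicClosure E₁) x) =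
      algebraMap E₂ (AlgebraicClosure E₂) (γ x))
    (x : E₁ˣ) {σ : absoluteGaloisGroup E₁} {σ' : absoluteGaloisGroup E₂}
    (hσ' : absGaloisRestrict F E₂ σ' =
      WeilGroup.toAbsGalois F ρ * absGaloisRestrict F E₁ σ * (WeilGroup.toAbsGalois F ρ)⁻¹)
    (hσ : σ ∈ (isReciprocitySystemE (F := F) (E := E₁) hcf).Reps x) :
    σ' ∈ (isReciprocitySystemE (F := F) (E := E₂) hcf).Reps (Units.map (γ : E₁ →* E₂) x) := by
  intro M _ _
  -- `L' = φ⁻¹ M`, a finite abelian extension of `E₁` with `φ L' = M`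
  have hφ' : ∀ y : E₂, φ.symm (algebraMap E₂ (AlgebraicClosure E₂) y) =
      algebraMap E₁ (AlgebraicClosure E₁) (γ.symm y) := fun y => by
    rw [RingEquiv.symm_apply_eq, hφ, RingEquiv.apply_symm_apply]
  obtain ⟨L', hL'⟩ := exists_intermediateField_semilinearImage₂ hφ' M
  have hM : ∀ z, z ∈ M ↔ φ.symm z ∈ L' := fun z => by
    rw [hL', RingEquiv.symm_symm, RingEquiv.apply_symm_apply]
  haveI := finiteDimensional_semilinearImage₂ hφ' hL'
  haveI := isAbelianGalois_semilinearImage₂ hφ' hL'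
  -- `σ|_{L'} = (x, L'/E₁) = w|_{L'}` for some `w ∈ U_{E₁}`
  obtain ⟨w, hw⟩ := weilRestrictE_surjective F E₁ L' (recSystemE hcf L' x)
  have h1 : AlgEquiv.restrictNormalHom L' (absoluteGaloisGroup.toAlgEquiv E₁ σ) =
      AlgEquiv.restrictNormalHom L' (absoluteGaloisGroup.toAlgEquiv E₁
        (liftGal F E₁ ((toAbsGalois_mem_galFixing_iff (F := F)).mpr w.2))) := by
    rw [hσ L', ← hw, weilRestrictE_apply]
  -- finite-level equivariance: `(γ x, M/E₂) = (ρ w ρ⁻¹)|_M`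
  rw [recSystemE_semilinearImage₂ hcf ρ hρ hφι hφ hM x w hw.symm, weilRestrictE_apply]
  refine restrictNormalHom_eq_of_semilinear_conj₂ hM
    (smul_map_of_absGaloisRestrict_eq_conj₂ F E₁ E₂ hφι hσ')
    (smul_map_of_absGaloisRestrict_eq_conj₂ F E₁ E₂ hφι ?_) h1
  rw [absGaloisRestrict_liftGal, absGaloisRestrict_liftGal]
  simp only [map_mul, map_inv]

end Reps

/-! ### §5 Conjugation-equivariance of characterised reciprocity maps across two fields -/

section Art

variable (F E₁ E₂ : Type*) [Field F] [ValuativeRel F] [TopologicalSpace F]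
  [IsNonarchimedeanLocalField F]
  [Field E₁] [Algebra F E₁] [FiniteDimensional F E₁] [Algebra.IsSeparable F E₁]
  [ValuativeRel E₁] [TopologicalSpace E₁] [IsNonarchimedeanLocalField E₁] [ValuativeExtension F E₁]
  [Field E₂] [Algebra F E₂] [FiniteDimensional F E₂] [Algebra.IsSeparable F E₂]
  [ValuativeRel E₂] [TopologicalSpace E₂] [IsNonarchimedeanLocalField E₂] [ValuativeExtension F E₂]

/-- **`Art_{gK}(g u) = g̃ · Art_K(u) · g̃⁻¹` across two finite subextensions** (Neukirch IV (5.8):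
"`(σ a, σL|σK) = σ (a, L|K) σ⁻¹`"; [AbsAnab] §1.2 p. 9–11, the naturality of the local reciprocity
maps under `G_k`-conjugation used for Prop. 1.2.1 (iv), (vi)): for ANY homomorphisms
`Art_i : E_{i0}ˣ → Gal(F̄/E_{i0})^ab` (`E_{i0} = ι_i⁻¹(E_i) ⊆ F̄`) characterised by the finite abelian
shadows of Serre's `θ_{E_i}` (the characterisation clause of the cell's
`exists_reciprocity_characterized_embField`: `Art u = [h] ↔ h|_{L'} = (ι⁻¹u, L'/E)` for all finite
abelian `L'`), and ANY `g ∈ Γ_F` with `g E₁₀ = E₂₀`: if `u₂ = g · u`, `h₂ = g h g⁻¹` and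
`Art₁ u = [h]`, then `Art₂ u₂ = [h₂]`.  Proof: by the density of `W_F` in `Γ_F` write `g k = ρ̂`
with `k ∈ G_{E₁₀}` (acting trivially on `E₁₀` and innerly on `G_{E₁₀}^ab`), and apply §4 to the
conjugation data `(φ_ρ, γ_ρ)` of `ρ̂`. No normality of `E₁`, `E₂` over `F` is assumed.
[cite: NeukirchANT1999, Ch. IV Prop. (5.8)] -/
theorem reciprocity_conj_of_characterized
    (Art₁ : (embField F E₁)ˣ →* TopologicalAbelianization (galFixing F (embField F E₁)))
    (Art₂ : (embField F E₂)ˣ →* TopologicalAbelianization (galFixing F (embField F E₂)))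
    (hchar₁ : ∀ (u : (embField F E₁)ˣ) (h : galFixing F (embField F E₁)),
      Art₁ u = QuotientGroup.mk h ↔
        ∀ (L' : IntermediateField E₁ (AlgebraicClosure E₁)) [FiniteDimensional E₁ L']
            [IsAbelianGalois E₁ L'],
          AlgEquiv.restrictNormalHom L' (absoluteGaloisGroup.toAlgEquiv E₁ (liftGal F E₁ h.2)) =
            recSystemE (isClassFieldTheory_localWeilDatum F) L'
              (Units.map ((equivEmbField F E₁).symm : embField F E₁ →* E₁) u))
    (hchar₂ : ∀ (u : (embField F E₂)ˣ) (h : galFixing F (embField F E₂)),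
      Art₂ u = QuotientGroup.mk h ↔
        ∀ (L' : IntermediateField E₂ (AlgebraicClosure E₂)) [FiniteDimensional E₂ L']
            [IsAbelianGalois E₂ L'],
          AlgEquiv.restrictNormalHom L' (absoluteGaloisGroup.toAlgEquiv E₂ (liftGal F E₂ h.2)) =
            recSystemE (isClassFieldTheory_localWeilDatum F) L'
              (Units.map ((equivEmbField F E₂).symm : embField F E₂ →* E₂) u))
    (g : absoluteGaloisGroup F) (hg : ∀ a, g • a ∈ embField F E₂ ↔ a ∈ embField F E₁)
    (u : (embField F E₁)ˣ) (u₂ : (embField F E₂)ˣ)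
    (h : galFixing F (embField F E₁)) (h₂ : galFixing F (embField F E₂))
    (hu : ((u₂ : embField F E₂) : AlgebraicClosure F) = g • ((u : embField F E₁) : AlgebraicClosure F))
    (hh : (h₂ : absoluteGaloisGroup F) = g * h * g⁻¹)
    (hArt : Art₁ u = QuotientGroup.mk h) : Art₂ u₂ = QuotientGroup.mk h₂ := by
  classical
  haveI := finiteDimensional_embField F E₁
  set hcf := isClassFieldTheory_localWeilDatum F
  set eE₁ : E₁ ≃ₐ[F] embField F E₁ := equivEmbField F E₁
  set eE₂ : E₂ ≃ₐ[F] embField F E₂ := equivEmbField F E₂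
  -- density: `ρ̂ = g k` with `ρ ∈ W_F`, `k ∈ G_{E₁₀}`
  obtain ⟨ρ, hρ⟩ := exists_toAbsGalois_mem_smul_galFixing F (embField F E₁) g
  obtain ⟨k, hk, hgk⟩ := Set.mem_smul_set.mp hρ
  rw [smul_eq_mul] at hgk
  -- replace `h` by `k⁻¹ h k` (same class in the abelianisation) and `g` by `ρ̂ = g k`
  let h₁ : galFixing F (embField F E₁) := ⟨k⁻¹ * h * k, mul_mem (mul_mem (inv_mem hk) h.2) hk⟩
  have hcls : (QuotientGroup.mk h : TopologicalAbelianization (galFixing F (embField F E₁))) =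
      QuotientGroup.mk h₁ := by
    have : h₁ = (⟨k, hk⟩ : galFixing F (embField F E₁))⁻¹ * h * ⟨k, hk⟩ := Subtype.ext rfl
    rw [this, QuotientGroup.mk_mul, QuotientGroup.mk_mul, QuotientGroup.mk_inv, inv_mul_cancel_comm]
  have hu' : ((u₂ : embField F E₂) : AlgebraicClosure F) =
      WeilGroup.toAbsGalois F ρ • ((u : embField F E₁) : AlgebraicClosure F) := by
    rw [hu, ← hgk, mul_smul, (mem_galFixing_iff F).mp hk _ (u : embField F E₁).2]
  have hh₁' : (h₂ : absoluteGaloisGroup F) =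
      WeilGroup.toAbsGalois F ρ * h₁ * (WeilGroup.toAbsGalois F ρ)⁻¹ := by
    change (h₂ : absoluteGaloisGroup F) =
      WeilGroup.toAbsGalois F ρ * (k⁻¹ * h * k) * (WeilGroup.toAbsGalois F ρ)⁻¹
    rw [hh, ← hgk]
    group
  -- `ρ̂` maps `E₁₀` onto `E₂₀` (`k` fixes `E₁₀` pointwise)
  have hρE : ∀ a, WeilGroup.toAbsGalois F ρ • a ∈ embField F E₂ ↔ a ∈ embField F E₁ := by
    intro a
    rw [← hgk, mul_smul, hg]
    constructor
    · intro hka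
      have e : k⁻¹ • k • a = k • a := (mem_galFixing_iff F).mp (inv_mem hk) _ hka
      rw [inv_smul_smul] at e
      rw [e]
      exact hka
    · intro ha
      rwa [(mem_galFixing_iff F).mp hk _ ha]
  rw [hcls] at hArt
  -- the conjugation data of `ρ̂`
  obtain ⟨φ, hφι⟩ := exists_ringEquiv_conj_absClosureEmbedding₂ F E₁ E₂ (WeilGroup.toAbsGalois F ρ)
  obtain ⟨γ, hφ⟩ := exists_ringEquiv_semilinear₂ F E₁ E₂ hρE hφι
  -- `ι₂ u₂ = γ (ι₁ u)`
  have hγu : Units.map (eE₂.symm : embField F E₂ →* E₂) u₂ =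
      Units.map (γ : E₁ →* E₂) (Units.map (eE₁.symm : embField F E₁ →* E₁) u) := by
    ext
    apply (algebraMap E₂ (AlgebraicClosure E₂)).injective
    change algebraMap E₂ (AlgebraicClosure E₂) (eE₂.symm (u₂ : embField F E₂)) =
      algebraMap E₂ (AlgebraicClosure E₂) (γ (eE₁.symm (u : embField F E₁)))
    rw [← hφ, ← absClosureEmbedding_coe_eq, ← absClosureEmbedding_coe_eq, hu', hφι]
  -- apply the representatives transport
  have hmem' : WeilGroup.toAbsGalois F ρ * (h₁ : absoluteGaloisGroup F) *
      (WeilGroup.toAbsGalois F ρ)⁻¹ ∈ galFixing F (embField F E₂) :=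
    conj_mem_galFixing₂ F E₁ E₂ hρE h₁.2
  have key := mem_reps_of_absGaloisRestrict_eq_conj₂ hcf ρ hρE hφι hφ
    (Units.map (eE₁.symm : embField F E₁ →* E₁) u) (σ := liftGal F E₁ h₁.2)
    (σ' := liftGal F E₂ hmem')
    (by rw [absGaloisRestrict_liftGal, absGaloisRestrict_liftGal])
    ((IsReciprocitySystem.mem_reps_iff _).mpr ((hchar₁ u h₁).mp hArt))
  have hh'eq : h₂ = ⟨_, hmem'⟩ := Subtype.ext hh₁'
  rw [hh'eq, hchar₂, hγu]
  exact (IsReciprocitySystem.mem_reps_iff _).mp key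

end Art

end LocalWeilDatum

end Literature.NumberTheory.GaloisRepresentations
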